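import Summits.QuantumFields.YangMills.Theorems.BalabanUVNodesPortS1JacobianPieces

/-!
# NODE O port PT-A — THE JACOBIAN FACTORS `|det A₁(c)(V^{(k)})|` OF (1.4)'s δ-FUNCTION ELIMINATION ARE GAUGE INVARIANT: under `V ↦ V^u` the `b₀`-block transforms as
# `A₁(c)(V^u) = Ad(u(c₋)) · A₁(c)(V) · Ad(u(b₀(c)₋)*)` in `su2Coord` coordinates, and the adjoint matrices `Ad(g)_{jj′} = su2Coord(g·su2Gen j′·g*)_j` are ORTHOGONAL (`|det| = 1`)
# — the (1.19)∕(2.16) row of the δ-Jacobian bracket `Σ_c log|det A₁(c)|` of `phiLZ_eq_logDet_sum` at `SU(2)` points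

Cell `ym-nodeO-ideate`, porter seat `ymgap-nodeO-port-PTA-1` (gen 5); `--supports stmt-QuantumFields-27930` (helper; companion of ✓p812054 `…PortS1JacobianPieces`, whose ★★ `recordLQt_gaugeAct`
(`LQ̃(V^u) = Ad_{u(c₋)} ∘ LQ̃(V) ∘ R`) is read here in coordinates).  [I] = [Balaban1987RG1].
CONSUMED BY NAME, nothing modified: ✓p812054 (`recordLQt_gaugeAct`, `exists_rotCLM`, `coe_mul_star_self_SU`, `star_mul_coe_self_SU`), ✓p811778 (`b0Block_mulVec`, `sum_su2Coord_smul_su2Gen`,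
`sum_smul_su2Gen_mem_lieSU`), ✓p811152 (`recordLQt_mem_lieSU_of_small`), ✓p810869 (`fluctMat_smul_single`), DEF-1's `su2Gen ∕ su2Coord ∕ recordLQtB0`, `T4AdjointCovarianceUnitary.conj_mem_lieSU`.
* §1 𝔰𝔲(2) coordinates: `trace_su2Gen_mul` (`tr(iσ_j iσ_a) = −2δ`), `su2Coord_sum_smul`, `su2Coord_eq_re_trace` (`su2Coord M j = −½ Re tr(su2Gen j·M)` on 𝔰𝔲(2)), `su2Coord_conj_eq_sum`
  (conjugation in coordinates), `su2Coord_conj_star_eq` (`Ad(g*) = Ad(g)ᵀ`, cyclicity of the trace), `adMat_star_mul_adMat` (`Ad(g*)·Ad(g) = 1`), ★ `abs_det_adMat` (`|det Ad(g)| = 1`).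
* §2 `apply_eq_su2Coord_fluctMat`, `fluctMat_single`, `recordLQtB0_gaugeAct_apply`, ★★ `b0Block_gaugeAct`, ★★ `abs_det_b0Block_gaugeAct`, ★ `log_abs_det_b0Block_gaugeAct`.

HONEST FRAMING.  Finite-dimensional linear algebra over the tree's own theorems; NOTHING of Bałaban's estimates asserted, ported or discharged; `SU(2)` points only (the `SL(2,ℂ)` row (1.19) on complex pairs
is NOT here); `stub_LZ` BLOCKED-ON P0 (α)+(β), `stub_FE` XXL; 27930 OPEN · no claim; K0⁷∕K-Ax OPEN; NODE O 0∕1; COUNT 8∕28 · K 1∕4 UNMOVED; finite `𝕋⁴_{L^K}` at fixed ε — NOT continuum ∕ OS ∕ Clay;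
**the Yang–Mills mass gap is NOT proved by any of this.**  No `sorry`, no `def`, no `instance`, no `notation`; standard axioms.
-/

noncomputable section

open scoped BigOperators Matrix.Norms.L2Operator Topology

namespace Summit.QuantumFields.YangMills.Theorems.BalabanUVNodesPortS1

open Summit.QuantumFields.YangMills.Theorems.K0RecordFormatNames
open Summit.QuantumFields.YangMills.BalabanUVNodes
open Literature.MathematicalPhysics.QuantumFieldTheory.Balaban1983to89
open Literature.MathematicalPhysics.QuantumFieldTheory.Balaban1983to89.Node00
open Literature.MathematicalPhysics.QuantumFieldTheory.Balaban1983to89.T4Continuum (T4Family)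
open Literature.MathematicalPhysics.QuantumFieldTheory.Balaban1983to89.BlockAveraging (avgFun loopHol Small Idx small_gaugeAct_iff)
open Literature.MathematicalPhysics.QuantumFieldTheory.Balaban1983to89.BlockAveragingHaarAC (centralBond)
open Literature.MathematicalPhysics.QuantumFieldTheory.Balaban1983to89.ExpMeanLog (expMeanLogSU)
open Literature.MathematicalPhysics.QuantumFieldTheory.Balaban1983to89.T4AdjointCovarianceUnitary (lieSU mem_lieSU_iff conj_mem_lieSU)
open _root_.Matrix _root_.Filter

variable (F : T4Family)

/-! ## §1  𝔰𝔲(2) coordinates: trace formula, conjugation in coordinates, the adjoint matrix is orthogonal -/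

/-- `tr(su2Gen j · su2Gen a) = −2δ_{ja}` (`su2Gen a = iσ_a`). [folklore] -/
theorem trace_su2Gen_mul (j a : Fin 3) : Matrix.trace (su2Gen j * su2Gen a) = if j = a then (-2 : ℂ) else 0 := by
  fin_cases j <;> fin_cases a <;> simp [su2Gen, Matrix.trace, Fin.sum_univ_two] <;> norm_num

/-- `su2Coord` is real-linear: coordinates of a real combination. [folklore] -/
theorem su2Coord_sum_smul (N : Fin 3 → MatA 2) (m : Fin 3 → ℝ) (j : Fin 3) :
    su2Coord (∑ a, ((m a : ℝ) : ℂ) • N a) j = ∑ a, m a * su2Coord (N a) j := by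
  fin_cases j <;> simp [su2Coord, Matrix.sum_apply, Matrix.smul_apply, Complex.re_sum, Complex.im_sum]

/-- **The coordinates as traces**: for `M ∈ 𝔰𝔲(2)`, `su2Coord M j = −½ Re tr(su2Gen j · M)`. [folklore] -/
theorem su2Coord_eq_re_trace {M : MatA 2} (hM : M ∈ lieSU (Fin 2)) (j : Fin 3) :
    su2Coord M j = -(1 / 2) * (Matrix.trace (su2Gen j * M)).re := by
  have hM' : M = ∑ a, ((su2Coord M a : ℝ) : ℂ) • su2Gen a := (sum_su2Coord_smul_su2Gen hM).symm
  conv_rhs => rw [hM']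
  simp only [Matrix.mul_sum, Matrix.mul_smul, Matrix.trace_sum, Matrix.trace_smul, trace_su2Gen_mul, smul_eq_mul, mul_ite, mul_neg, mul_zero,
    Finset.sum_ite_eq, Finset.mem_univ, if_true, Complex.neg_re, Complex.mul_re, Complex.ofReal_re, Complex.ofReal_im]
  have h2 : (2 : ℂ).re = 2 := by norm_num
  rw [h2]
  ring

/-- **Conjugation in coordinates**: for `M ∈ 𝔰𝔲(2)`, `su2Coord(g M g*)_j = Σ_{j′} su2Coord(g·su2Gen j′·g*)_j · su2Coord(M)_{j′}`. [folklore] -/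
theorem su2Coord_conj_eq_sum (g : MatA 2) {M : MatA 2} (hM : M ∈ lieSU (Fin 2)) (j : Fin 3) :
    su2Coord (g * M * star g) j = ∑ j', su2Coord (g * su2Gen j' * star g) j * su2Coord M j' := by
  have hM' : M = ∑ a, ((su2Coord M a : ℝ) : ℂ) • su2Gen a := (sum_su2Coord_smul_su2Gen hM).symm
  have hconj : g * M * star g = ∑ a, ((su2Coord M a : ℝ) : ℂ) • (g * su2Gen a * star g) := by
    conv_lhs => rw [hM']
    simp only [Matrix.mul_sum, Matrix.sum_mul, Matrix.mul_smul, Matrix.smul_mul]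
  rw [hconj, su2Coord_sum_smul]
  exact Finset.sum_congr rfl fun a _ => mul_comm _ _

/-- A matrix with `g g* = 1` as an element of the unitary group. [folklore] -/
theorem mem_unitaryGroup_of_mul_star {g : MatA 2} (hg : g * star g = 1) : g ∈ Matrix.unitaryGroup (Fin 2) ℂ :=
  Matrix.mem_unitaryGroup_iff.mpr hg

/-- **The adjoint matrix of `g*` is the transpose of that of `g`** (`tr` is cyclic). [folklore] -/
theorem su2Coord_conj_star_eq (g : MatA 2) (hg : g * star g = 1) (j j' : Fin 3) :
    su2Coord (star g * su2Gen j' * g) j = su2Coord (g * su2Gen j * star g) j' := by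
  have h1 : star g * su2Gen j' * g ∈ lieSU (Fin 2) := by
    have h := conj_mem_lieSU (sum_smul_su2Gen_mem_lieSU (Pi.single j' 1) |> fun h => by simpa using h : su2Gen j' ∈ lieSU (Fin 2))
      ⟨star g, Unitary.star_mem (mem_unitaryGroup_of_mul_star hg)⟩
    simpa only [star_star] using h
  have h2 : g * su2Gen j * star g ∈ lieSU (Fin 2) :=
    conj_mem_lieSU (sum_smul_su2Gen_mem_lieSU (Pi.single j 1) |> fun h => by simpa using h : su2Gen j ∈ lieSU (Fin 2)) ⟨g, mem_unitaryGroup_of_mul_star hg⟩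
  rw [su2Coord_eq_re_trace h1, su2Coord_eq_re_trace h2]
  congr 2
  calc Matrix.trace (su2Gen j * (star g * su2Gen j' * g)) = Matrix.trace ((star g * su2Gen j' * g) * su2Gen j) := Matrix.trace_mul_comm _ _
    _ = Matrix.trace (star g * (su2Gen j' * g * su2Gen j)) := by rw [Matrix.mul_assoc, Matrix.mul_assoc, Matrix.mul_assoc]
    _ = Matrix.trace ((su2Gen j' * g * su2Gen j) * star g) := Matrix.trace_mul_comm _ _
    _ = Matrix.trace (su2Gen j' * (g * su2Gen j * star g)) := by rw [Matrix.mul_assoc, Matrix.mul_assoc, Matrix.mul_assoc]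

/-- **The adjoint matrices of `g*` and `g` are inverse to each other** (`Ad_{g*} ∘ Ad_g = id`). [folklore] -/
theorem adMat_star_mul_adMat (g : MatA 2) (hg : g * star g = 1) (hg' : star g * g = 1) :
    (Matrix.of fun j j' : Fin 3 => su2Coord (star g * su2Gen j' * g) j) * (Matrix.of fun j j' : Fin 3 => su2Coord (g * su2Gen j' * star g) j) = 1 := by
  ext j a
  rw [Matrix.mul_apply, Matrix.one_apply]
  simp only [Matrix.of_apply]
  have hM : g * su2Gen a * star g ∈ lieSU (Fin 2) :=
    conj_mem_lieSU (sum_smul_su2Gen_mem_lieSU (Pi.single a 1) |> fun h => by simpa using h : su2Gen a ∈ lieSU (Fin 2)) ⟨g, mem_unitaryGroup_of_mul_star hg⟩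
  have h := su2Coord_conj_eq_sum (star g) hM j
  rw [star_star] at h
  have hlhs : star g * (g * su2Gen a * star g) * g = su2Gen a := by
    calc star g * (g * su2Gen a * star g) * g = (star g * g) * su2Gen a * (star g * g) := by noncomm_ring
      _ = su2Gen a := by rw [hg', one_mul, mul_one]
  rw [hlhs] at h
  rw [← h]
  have hgen : su2Coord (su2Gen a) j = if j = a then 1 else 0 := by
    fin_cases j <;> fin_cases a <;> simp [su2Coord, su2Gen]
  exact hgen

/-- ★ **THE ADJOINT MATRIX IS ORTHOGONAL, so `|det| = 1`**. [folklore] -/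
theorem abs_det_adMat (g : MatA 2) (hg : g * star g = 1) (hg' : star g * g = 1) :
    |(Matrix.of fun j j' : Fin 3 => su2Coord (g * su2Gen j' * star g) j).det| = 1 := by
  set T : Matrix (Fin 3) (Fin 3) ℝ := Matrix.of fun j j' : Fin 3 => su2Coord (g * su2Gen j' * star g) j with hT
  have htr : (Matrix.of fun j j' : Fin 3 => su2Coord (star g * su2Gen j' * g) j) = Tᵀ := by
    ext j j'
    rw [Matrix.transpose_apply, Matrix.of_apply, hT, Matrix.of_apply]
    exact su2Coord_conj_star_eq g hg j j'
  have h := adMat_star_mul_adMat g hg hg'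
  rw [htr] at h
  have hdet := congrArg Matrix.det h
  rw [Matrix.det_mul, Matrix.det_transpose, Matrix.det_one] at hdet
  have h2 : |T.det| * |T.det| = 1 := by rw [← abs_mul, hdet, abs_one]
  nlinarith [abs_nonneg T.det]

/-! ## §2  ★★ The `b₀`-blocks transform by adjoint matrices under gauge transformations; `|det A₁(c)|` is gauge invariant -/

/-- A coordinate vector is read off its 𝔰𝔲(2) matrices bondwise. [folklore] -/
theorem apply_eq_su2Coord_fluctMat (k K : ℕ) (x : FluctIdx F k K → ℝ) (i : FluctIdx F k K) : x i = su2Coord (fluctMat F k K x i.1) i.2 := by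
  rw [fluctMat, su2Coord_sum_smul_su2Gen]

/-- `fluctMat (e_{(β,a)}) b = δ_{bβ} su2Gen a`. [folklore] -/
theorem fluctMat_single (k K : ℕ) (β : PBond (F.P K) k) (a : Fin 3) (b : PBond (F.P K) k) :
    fluctMat F k K (Pi.single (β, a) (1 : ℝ)) b = if b = β then su2Gen a else 0 := by
  classical
  have h := fluctMat_smul_single F k K β a 1
  rw [one_smul, Complex.ofReal_one, one_smul] at h
  by_cases hb : b = β
  · subst hb; rw [if_pos rfl]; exact h
  · rw [if_neg hb, fluctMat]
    refine Finset.sum_eq_zero fun a' _ => ?_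
    have : ((b, a') : FluctIdx F k K) ≠ (β, a) := fun h' => hb (Prod.mk.inj h').1
    simp [Pi.single_eq_of_ne this]

open Classical in
/-- **The `b₀`-block entries transform by adjoint matrices** (entrywise form): at a background in the guard,
`A₁(c)(V^u)_{ja} = Σ_{j′a′} Ad(u(c₋))_{jj′} · A₁(c)(V)_{j′a′} · Ad(u(b₀(c)₋)*)_{a′a}` (`recordLQt_gaugeAct` + conjugation in coordinates + `b0Block_mulVec`).
[cite: Balaban1987RG1, (2.16) p.269, p.267–268] -/
theorem recordLQtB0_gaugeAct_apply (k K : ℕ) (hk : k + 1 ≤ (F.P K).m + (F.P K).K) (u : GaugeTransf (F.P K) k (SU 2)) (Vk : GaugeField (F.P K) k (SU 2))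
    (hs : ∀ c : PBond (F.P K) (k + 1), Small expMeanLogSU Vk c) (c : PBond (F.P K) (k + 1)) (j a : Fin 3) :
    recordLQtB0 F k K (GaugeField.gaugeAct u Vk) (c, j) (c, a) =
      ∑ j', su2Coord (((u (emb c.src) : SU 2) : MatA 2) * su2Gen j' * star ((u (emb c.src) : SU 2) : MatA 2)) j *
        ∑ a', recordLQtB0 F k K Vk (c, j') (c, a') *
          su2Coord (star ((u (recordB0 F k K c).src : SU 2) : MatA 2) * su2Gen a * ((u (recordB0 F k K c).src : SU 2) : MatA 2)) a' := by
  obtain ⟨R, hR⟩ := exists_rotCLM F k K u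
  -- the left-hand side through the covariance of `LQ̃`
  have hL : recordLQtB0 F k K (GaugeField.gaugeAct u Vk) (c, j) (c, a) =
      su2Coord (((u (emb c.src) : SU 2) : MatA 2) * recordLQt F k K Vk (R (Pi.single (recordB0 F k K c, a) (1 : ℝ))) c * star ((u (emb c.src) : SU 2) : MatA 2)) j := by
    show su2Coord (recordLQt F k K (GaugeField.gaugeAct u Vk) (Pi.single (recordB0 F k K c, a) (1 : ℝ)) c) j = _
    rw [recordLQt_gaugeAct F k K hk u Vk hs R hR]
  -- the rotated basis vector is the bond vector at `b₀(c)` with coefficients `Ad(u_β*)(·, a)`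
  have hRe : R (Pi.single (recordB0 F k K c, a) (1 : ℝ)) = fun i : FluctIdx F k K =>
      if i.1 = recordB0 F k K c then su2Coord (star ((u (recordB0 F k K c).src : SU 2) : MatA 2) * su2Gen a * ((u (recordB0 F k K c).src : SU 2) : MatA 2)) i.2 else 0 := by
    funext i
    rw [apply_eq_su2Coord_fluctMat F k K (R (Pi.single (recordB0 F k K c, a) (1 : ℝ))) i, hR, fluctMat_single]
    by_cases hi : i.1 = recordB0 F k K c
    · rw [if_pos hi, if_pos hi, hi]
    · rw [if_neg hi, if_neg hi, mul_zero, zero_mul]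
      obtain ⟨b, a'⟩ := i
      fin_cases a' <;> simp [su2Coord]
  have hmem : recordLQt F k K Vk (R (Pi.single (recordB0 F k K c, a) (1 : ℝ))) c ∈ lieSU (Fin 2) := recordLQt_mem_lieSU_of_small F k K Vk hs _ c
  rw [hL, su2Coord_conj_eq_sum _ hmem j]
  refine Finset.sum_congr rfl fun j' _ => ?_
  have hb := b0Block_mulVec F k K Vk c (fun a' => su2Coord (star ((u (recordB0 F k K c).src : SU 2) : MatA 2) * su2Gen a * ((u (recordB0 F k K c).src : SU 2) : MatA 2)) a') j'
  simp only [Matrix.mulVec, dotProduct, Matrix.of_apply] at hb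
  have hrow : su2Coord (recordLQt F k K Vk (R (Pi.single (recordB0 F k K c, a) (1 : ℝ))) c) j' =
      ∑ a', recordLQtB0 F k K Vk (c, j') (c, a') *
        su2Coord (star ((u (recordB0 F k K c).src : SU 2) : MatA 2) * su2Gen a * ((u (recordB0 F k K c).src : SU 2) : MatA 2)) a' := by
    rw [hRe, ← hb]
  rw [hrow]

open Classical in
/-- ★★ **THE `b₀`-BLOCKS TRANSFORM BY ADJOINT MATRICES**: at a background in the guard, `A₁(c)(V^u) = Ad(u(c₋)) · A₁(c)(V) · Ad(u(b₀(c)₋)*)` in `su2Coord` coordinates.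
[cite: Balaban1987RG1, (2.16) p.269, p.267–268] -/
theorem b0Block_gaugeAct (k K : ℕ) (hk : k + 1 ≤ (F.P K).m + (F.P K).K) (u : GaugeTransf (F.P K) k (SU 2)) (Vk : GaugeField (F.P K) k (SU 2))
    (hs : ∀ c : PBond (F.P K) (k + 1), Small expMeanLogSU Vk c) (c : PBond (F.P K) (k + 1)) :
    (Matrix.of fun j j' : Fin 3 => recordLQtB0 F k K (GaugeField.gaugeAct u Vk) (c, j) (c, j')) =
      (Matrix.of fun j j' : Fin 3 => su2Coord (((u (emb c.src) : SU 2) : MatA 2) * su2Gen j' * star ((u (emb c.src) : SU 2) : MatA 2)) j) *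
        (Matrix.of fun j j' : Fin 3 => recordLQtB0 F k K Vk (c, j) (c, j')) *
        (Matrix.of fun j j' : Fin 3 => su2Coord (star ((u (recordB0 F k K c).src : SU 2) : MatA 2) * su2Gen j' * ((u (recordB0 F k K c).src : SU 2) : MatA 2)) j) := by
  ext j a
  rw [Matrix.mul_assoc, Matrix.mul_apply]
  simp only [Matrix.mul_apply, Matrix.of_apply]
  exact recordLQtB0_gaugeAct_apply F k K hk u Vk hs c j a

open Classical in
/-- ★★ **THE JACOBIAN FACTORS ARE GAUGE INVARIANT**: `|det A₁(c)(V^u)| = |det A₁(c)(V)|` at every background in the (0.4) guard (adjoint matrices are orthogonal).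
[cite: Balaban1987RG1, (2.16) p.269, (1.19) p.263, p.268] -/
theorem abs_det_b0Block_gaugeAct (k K : ℕ) (hk : k + 1 ≤ (F.P K).m + (F.P K).K) (u : GaugeTransf (F.P K) k (SU 2)) (Vk : GaugeField (F.P K) k (SU 2))
    (hs : ∀ c : PBond (F.P K) (k + 1), Small expMeanLogSU Vk c) (c : PBond (F.P K) (k + 1)) :
    |(Matrix.of fun j j' : Fin 3 => recordLQtB0 F k K (GaugeField.gaugeAct u Vk) (c, j) (c, j')).det| =
      |(Matrix.of fun j j' : Fin 3 => recordLQtB0 F k K Vk (c, j) (c, j')).det| := by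
  rw [b0Block_gaugeAct F k K hk u Vk hs c, Matrix.det_mul, Matrix.det_mul, abs_mul, abs_mul,
    abs_det_adMat _ (coe_mul_star_self_SU _) (star_mul_coe_self_SU _)]
  have h2 : |(Matrix.of fun j j' : Fin 3 => su2Coord (star ((u (recordB0 F k K c).src : SU 2) : MatA 2) * su2Gen j' *
      ((u (recordB0 F k K c).src : SU 2) : MatA 2)) j).det| = 1 := by
    have h := abs_det_adMat (star ((u (recordB0 F k K c).src : SU 2) : MatA 2))
      (by rw [star_star]; exact star_mul_coe_self_SU _) (by rw [star_star]; exact coe_mul_star_self_SU _)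
    simpa only [star_star] using h
  rw [h2, one_mul, mul_one]

open Classical in
/-- ★ **… and so is the Jacobian term `log|det A₁(c)|` of the δ-Jacobian bracket** ((1.19) for the Jacobian pieces at `SU(2)` points). [cite: Balaban1987RG1, (1.19) p.263, (2.16) p.269] -/
theorem log_abs_det_b0Block_gaugeAct (k K : ℕ) (hk : k + 1 ≤ (F.P K).m + (F.P K).K) (u : GaugeTransf (F.P K) k (SU 2)) (Vk : GaugeField (F.P K) k (SU 2))
    (hs : ∀ c : PBond (F.P K) (k + 1), Small expMeanLogSU Vk c) (c : PBond (F.P K) (k + 1)) :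
    Real.log |(Matrix.of fun j j' : Fin 3 => recordLQtB0 F k K (GaugeField.gaugeAct u Vk) (c, j) (c, j')).det| =
      Real.log |(Matrix.of fun j j' : Fin 3 => recordLQtB0 F k K Vk (c, j) (c, j')).det| := by
  rw [abs_det_b0Block_gaugeAct F k K hk u Vk hs c]

end Summit.QuantumFields.YangMills.Theorems.BalabanUVNodesPortS1

end
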